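import Mathlib
import HarnessLib
import Summits.HubbardSuperconductivity.HubbardSuperconductivity.Theses.KLProgramme
import Summits.HubbardSuperconductivity.HubbardSuperconductivity.Theorems.KLProgrammeKLRegimeChildrenV17F2

/-!
# Route `KLProgramme` — crux K3 gen-8 (7-flow, cure 1), the GLUE item `KLRegimeTwoPointLimitGlueV17F2 := KLRegimeEngineV17F2 → KLRegimeBetaSplitV17F2 →
# KLRegimeRenormFlowV17F2 → KLRegimeVolumeLimitV17F2 → KLRegimeTwoPointAssemblyV17F2 → KLRegimeTwoPointLimit`, CLOSED by the generic induction
# `KLRegimeSplit.KLRegimeTwoPointLimit_of_V17F2` (`…ChildrenV17F2`, = `KLRegimeInductionP4 klPredsV17F2 FinalTwoLegVolLimitEx`).  Proof only; nothing here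
# asserts superconductivity.
-/

noncomputable section

namespace Summit.HubbardSuperconductivity.HubbardSuperconductivity.Theorems.KLRegimeSplit

set_option linter.dupNamespace false -- summit = problem name (single-conjunct summit), D-0017

/-- The gen-8 (7-flow, cure 1) glue item holds: the five V17F2 children imply `KLRegimeTwoPointLimit`. -/
theorem klRegimeTwoPointLimitGlueV17F2_holds :
    Summit.HubbardSuperconductivity.HubbardSuperconductivity.Theses.KLProgramme.KLRegimeTwoPointLimitGlueV17F2 :=
  fun h₁ h₂ h₃ h₄ h₅ => KLRegimeTwoPointLimit_of_V17F2 h₁ h₂ h₃ h₄ h₅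

end Summit.HubbardSuperconductivity.HubbardSuperconductivity.Theorems.KLRegimeSplit

end
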